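import Literature.NumberTheory.Automorphic.SatakeParameterGenericBoundHolds
import HarnessLib

/-!
# Bessel descent along the column groups of `U_n(F)` for vectors of finite level

Topic `NumberTheory/Automorphic`; namespace `Literature.NumberTheory.Automorphic.WhittakerBessel`.
Theorems only (plus three explicit bookkeeping definitions with bodies: the integer shell exponents
`cvecZ`, the unit twists `unitDiag` of the torus, and the torus weight `wtZ` on `ℤ`-exponents); no named
fact, no instance, no `sorry`.

`SatakeParameterGenericBoundHolds` proves the Bessel descent of a unitarizable smooth representation
`ρ` of `GL_n(F)` (`F` non-archimedean local) along the column groups `C_t` of `U_n`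
(`IsLevel`, `descendForm`, `IsLevel.descend`) and, for a vector **fixed by `GL_n(𝒪)`**, the chain of
one-step Bessel inequalities (`IsLevel.bessel_step`, `chain`, `bessel_bound`) bounding the weighted torus
sum `∑_λ q^{w(λ)} Φ_m(ρ(ϖ^λ) v, ρ(ϖ^λ) v)` by `B(v, v)` — the square-integrability input of
Jacquet–Shalika's §1 for the spherical vector. This file proves the same inequalities for a vector of
**finite level**: fixed by the integral top-left points of a principal congruence subgroup
`K(ℓ) = 1 + ϖ^ℓ M_n(𝒪)` (`congruenceGL n |ϖ^ℓ|`), `ℓ ≥ 1`. Differences with the spherical case: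

* the shells now run over `k ∈ ℤ` (the Fourier support of a level-`ℓ` vector meets finitely many
  negative shells), with the scaling rule extended to `ϖ^{k 1_t}`, `k < 0` (`IsLevel.scale_cvecZ`);
* each shell is cut into the **thin cones** `ϖ^{-k}(u e_{t-1} + ϖ^ℓ 𝒪^t)` around the unit multiples
  `u e_{t-1}` of the axis, `u` in a set `U` of units pairwise incongruent modulo `ϖ^ℓ` (these are the
  pieces probed by the torus points `ϖ^λ · diag(u)`); the pieces are moved to the central **level-`ℓ`**
  projector `e_{-ℓ, e_{t-1}}` by `diag(…, u, …) ϖ^{k 1_t}` (`apply_zpowDiagGL_proj`, `apply_glInt_proj`),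
  which collapses onto the approximants of `Φ'` with index `q^{t(N - ℓ)}` because the row shears
  `1 + e_{t-1} ⊗ c̃`, `c̃ ∈ ϖ^ℓ 𝒪^t`, lie in `K(ℓ)` and are top-left (`form_proj_proj_eq_card_mul`);
* `IsLevel.bessel_step_level`:
  `∑_{k ∈ S} ∑_{u ∈ U} q^{jkt - ℓt} Φ'(ρ(D_u ϖ^{k 1_t}) y, ρ(D_u ϖ^{k 1_t}) y) ≤ Φ(y, y)`;
* `chain_level`, `bessel_bound_level`: iterating down the tower for `v` fixed by `K(ℓ)`,
  `∑_{(λ,μ)} q^{w(λ)} q^{-ℓ m(m+1)/2} Φ_m(ρ(ϖ^λ D_μ) v, ρ(ϖ^λ D_μ) v) ≤ B(v, v)` over finite sets of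
  exponents `λ ∈ ℤ^{m+1}` with `λ_m = 0` and unit tuples `μ ∈ U^{m}` (`D_μ = diag(μ)`), where
  `w(λ) = ∑ λ_i (m - 1 - 2i)` is the exponent of the Iwasawa Jacobian `δ_{B_m}⁻¹(ϖ^λ)`.

The tower hypotheses are taken in the weak form actually used (`B` Hermitian positive SEMI-definite with
`B(v,v) = 0 ⇒ Λ v = 0`, `isLevel_zero_of_nonneg`), which is the shape of the global application
(`B(θ, θ') = ∑_u ⟪S_{θ_u} f, S_{θ'_u} f⟫` on test weights). This is the local, finite-place half of the
absolute convergence at `s = 1` of the Rankin–Selberg integrals of unitary generic representations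
(Jacquet–Shalika (1981), §1, Prop. (1.5) and (3.17); Cogdell (2004), Thm. 3.1 / Getz–Hahn (2024),
Prop. 11.5.1 (a)), obtained without the Kirillov model.

## References

* H. Jacquet, J. A. Shalika, *On Euler products and the classification of automorphic
  representations I*, Amer. J. Math. 103 (1981), 499–558, §1 [JacquetShalikaAJM1981].
* J. R. Getz, H. Hahn, *An Introduction to Automorphic Representations*, GTM 300 (2024), §11.5,
  Prop. 11.5.1 (a) [GetzHahn2024].
* I. N. Bernstein, A. V. Zelevinsky, *Representations of the group `GL(n, F)` where `F` is a
  non-archimedean local field*, Russian Math. Surveys 31:3 (1976), §2.3, §5 [BernsteinZelevinsky1976].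
-/

noncomputable section

open scoped MatrixGroups ComplexConjugate
open ValuativeRel Matrix Finset

namespace Literature.NumberTheory.Automorphic

namespace WhittakerBessel

open WhittakerSupercuspidal Filter

variable {F : Type*} [Field F] [ValuativeRel F] {n : ℕ}
  {V : Type*} [AddCommGroup V] [Module ℂ V]
  {ρ : Representation ℂ (GL (Fin n) F) V} {ψ : AddChar F Circle} {ϖ : F}

/-! ### Integer shells and unit twists of the torus -/

omit [ValuativeRel F] in
/-- The exponent vector `k · 1_{<t}`, `k ∈ ℤ`, of the scalar `ϖ^k` of `GL_t`. [folklore] -/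
def cvecZ (t : Fin n) (k : ℤ) : Fin n → ℤ := fun i => if i < t then k else 0

omit [ValuativeRel F] in
/-- Entries of `cvecZ`. [folklore] -/
@[simp] theorem cvecZ_apply (t : Fin n) (k : ℤ) (i : Fin n) : cvecZ t k i = if i < t then k else 0 := rfl

omit [ValuativeRel F] in
/-- `cvecZ` of a natural number is `cvec`. [folklore] -/
theorem cvecZ_natCast (t : Fin n) (k : ℕ) : cvecZ t (k : ℤ) = cvec t k := rfl

omit [ValuativeRel F] in
/-- `cvecZ` is additive in the exponent. [folklore] -/
theorem cvecZ_add (t : Fin n) (k k' : ℤ) : cvecZ t (k + k') = cvecZ t k + cvecZ t k' := by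
  funext i; simp only [cvecZ_apply, Pi.add_apply]; split_ifs <;> simp

omit [ValuativeRel F] in
/-- `cvecZ t (-k) = - cvecZ t k`. [folklore] -/
theorem cvecZ_neg (t : Fin n) (k : ℤ) : cvecZ t (-k) = -cvecZ t k := by
  funext i; simp only [cvecZ_apply, Pi.neg_apply]; split_ifs <;> simp

omit [ValuativeRel F] in
/-- `∑_i (k · 1_{<t})_i = k t`. [folklore] -/
theorem sum_cvecZ (t : Fin n) (k : ℤ) : ∑ i, cvecZ t k i = k * t := by
  classical
  simp only [cvecZ_apply]
  rw [Finset.sum_ite, Finset.sum_const_zero, add_zero, Finset.sum_const, Finset.filter_gt_eq_Iio, Fin.card_Iio,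
    nsmul_eq_mul, mul_comm]

omit [ValuativeRel F] in
/-- `cvecZ` vanishes on the rows `≥ t`. [folklore] -/
theorem cvecZ_of_le {t i : Fin n} (h : t ≤ i) (k : ℤ) : cvecZ t k i = 0 := by
  simp only [cvecZ_apply, if_neg (not_lt.2 h)]

omit [ValuativeRel F] in
/-- `ϖ^{k · 1_{<t}}` commutes with the top-left matrices of size `t`. [folklore] -/
theorem zpowDiagGL_cvecZ_comm (hϖ0 : ϖ ≠ 0) {t : Fin n} (k : ℤ) {g : GL (Fin n) F}
    (hg : IsTopLeft t (g : Matrix (Fin n) (Fin n) F)) : g * zpowDiagGL hϖ0 (cvecZ t k) = zpowDiagGL hϖ0 (cvecZ t k) * g := by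
  apply Units.ext
  ext i l
  rw [Units.val_mul, Units.val_mul, coe_zpowDiagGL, Matrix.mul_diagonal, Matrix.diagonal_mul, cvecZ_apply, cvecZ_apply]
  by_cases hi : i < t
  · by_cases hl : l < t
    · rw [if_pos hi, if_pos hl, mul_comm]
    · rw [hg i l (Or.inr (not_lt.1 hl))]
      have : i ≠ l := fun e => hl (e ▸ hi)
      rw [if_neg this, zero_mul, mul_zero]
  · by_cases hil : i = l
    · subst hil; rw [mul_comm]
    · rw [hg i l (Or.inl (not_lt.1 hi)), if_neg hil, zero_mul, mul_zero]

/-- **The unit twist** `D_u = diag(1, …, 1, u, 1, …, 1)` (`u` at the row `tp`). [folklore] -/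
def unitDiag (tp : Fin n) (u : Fˣ) : GL (Fin n) F := diagonalGL (Fin n) F (Pi.mulSingle tp u)

omit [ValuativeRel F] in
/-- The matrix of the unit twist. [folklore] -/
theorem coe_unitDiag (tp : Fin n) (u : Fˣ) :
    ((unitDiag tp u : GL (Fin n) F) : Matrix (Fin n) (Fin n) F) = Matrix.diagonal fun i => if i = tp then (u : F) else 1 := by
  rw [unitDiag, coe_diagonalGL]
  congr 1; funext i
  by_cases h : i = tp
  · subst h; simp
  · simp [Pi.mulSingle, Function.update, h]

omit [ValuativeRel F] in
/-- The inverse of the unit twist is the twist by the inverse unit. [folklore] -/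
theorem unitDiag_inv (tp : Fin n) (u : Fˣ) : (unitDiag tp u)⁻¹ = (unitDiag tp u⁻¹ : GL (Fin n) F) := by
  rw [unitDiag, unitDiag, ← map_inv, Pi.mulSingle_inv]

/-- The unit twist is integral when `u` is a unit of `𝒪`. [folklore] -/
theorem unitDiag_mem_glInt (tp : Fin n) {u : Fˣ} (hu : valuation F (u : F) = 1) : unitDiag tp u ∈ glInt n F := by
  refine diagonalGL_mem_glInt fun i => ?_
  by_cases h : i = tp
  · subst h; simpa using hu
  · simp [Pi.mulSingle, Function.update, h]

omit [ValuativeRel F] in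
/-- The unit twist at a row `tp < t` is top-left of size `t`. [folklore] -/
theorem isTopLeft_unitDiag {t tp : Fin n} (htp : tp < t) (u : Fˣ) :
    IsTopLeft t ((unitDiag tp u : GL (Fin n) F) : Matrix (Fin n) (Fin n) F) := by
  intro r c h
  rw [coe_unitDiag, Matrix.diagonal_apply]
  by_cases hrc : r = c
  · subst hrc
    have : r ≠ tp := by
      rintro rfl
      rcases h with h | h <;> exact absurd htp (not_lt.2 h)
    rw [if_pos rfl, if_neg this, if_pos rfl]
  · rw [if_neg hrc, if_neg hrc]

omit [ValuativeRel F] in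
/-- Diagonal elements commute: `D_u ϖ^c = ϖ^c D_u`. [folklore] -/
theorem unitDiag_mul_zpowDiagGL_comm (hϖ0 : ϖ ≠ 0) (tp : Fin n) (u : Fˣ) (c : Fin n → ℤ) :
    unitDiag tp u * zpowDiagGL hϖ0 c = zpowDiagGL hϖ0 c * unitDiag tp u := by
  apply Units.ext
  rw [Units.val_mul, Units.val_mul, coe_unitDiag, coe_zpowDiagGL, Matrix.diagonal_mul_diagonal,
    Matrix.diagonal_mul_diagonal]
  congr 1; funext i; rw [mul_comm]

omit [ValuativeRel F] in
/-- `e_{tp} D_u⁻¹ = u⁻¹ e_{tp}`: the unit twist rescales the standard character. [folklore] -/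
theorem single_vecMul_unitDiag_inv (tp : Fin n) (u : Fˣ) (c : F) :
    (Pi.single tp c) ᵥ* (((unitDiag tp u)⁻¹ : GL (Fin n) F) : Matrix (Fin n) (Fin n) F) = Pi.single tp (c * (u⁻¹ : Fˣ)) := by
  rw [unitDiag_inv, coe_unitDiag]
  funext i
  rw [Matrix.vecMul_diagonal]
  by_cases h : i = tp
  · subst h; simp
  · simp [h]

/-- Conjugation by an integral unit twist preserves every principal congruence subgroup. [folklore] -/
theorem unitDiag_inv_mul_mul_mem_congruenceGL {tp : Fin n} {u : Fˣ} (hu : valuation F (u : F) = 1)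
    {γ : ValueGroupWithZero F} {g : GL (Fin n) F} (hg : g ∈ congruenceGL n γ) :
    (unitDiag tp u)⁻¹ * g * unitDiag tp u ∈ congruenceGL n γ := by
  -- entries of `D⁻¹ M D` are `d_i⁻¹ M_{ij} d_j` with units `d`
  set d : Fin n → F := fun i => if i = tp then (u : F) else 1 with hd
  have hdv : ∀ i, valuation F (d i) = 1 := fun i => by
    simp only [hd]; split_ifs
    · exact hu
    · exact map_one _
  have hdinv : ∀ i, valuation F (d i)⁻¹ = 1 := fun i => by rw [map_inv₀, hdv, inv_one]
  have hD : ((unitDiag tp u : GL (Fin n) F) : Matrix (Fin n) (Fin n) F) = Matrix.diagonal d := coe_unitDiag tp u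
  have hDinv : (((unitDiag tp u)⁻¹ : GL (Fin n) F) : Matrix (Fin n) (Fin n) F) = Matrix.diagonal fun i => (d i)⁻¹ := by
    rw [unitDiag_inv, coe_unitDiag]
    congr 1; funext i; simp only [hd]; split_ifs <;> simp
  have key : ∀ (M : Matrix (Fin n) (Fin n) F) (δ : ValueGroupWithZero F), ValBound δ M →
      ValBound δ ((Matrix.diagonal fun i => (d i)⁻¹) * M * Matrix.diagonal d) := by
    intro M δ hM i j
    rw [Matrix.mul_diagonal, Matrix.diagonal_mul, map_mul, map_mul, hdinv, hdv, one_mul, mul_one]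
    exact hM i j
  have hconj : ∀ M : Matrix (Fin n) (Fin n) F,
      (Matrix.diagonal fun i => (d i)⁻¹) * M * Matrix.diagonal d - 1 =
        (Matrix.diagonal fun i => (d i)⁻¹) * (M - 1) * Matrix.diagonal d := by
    intro M
    rw [Matrix.mul_sub, Matrix.sub_mul, Matrix.mul_one, Matrix.diagonal_mul_diagonal]
    congr 1
    rw [show (fun i => (d i)⁻¹ * d i) = fun _ => (1 : F) from funext fun i => inv_mul_cancel₀ (by
      intro h0; have := hdv i; rw [h0, map_zero] at this; exact zero_ne_one this), Matrix.diagonal_one]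
  rw [mem_congruenceGL_iff] at hg ⊢
  have e1 : (((unitDiag tp u)⁻¹ * g * unitDiag tp u : GL (Fin n) F) : Matrix (Fin n) (Fin n) F) =
      (Matrix.diagonal fun i => (d i)⁻¹) * (g : Matrix (Fin n) (Fin n) F) * Matrix.diagonal d := by
    rw [Units.val_mul, Units.val_mul, hDinv, hD]
  have e2 : ((((unitDiag tp u)⁻¹ * g * unitDiag tp u)⁻¹ : GL (Fin n) F) : Matrix (Fin n) (Fin n) F) =
      (Matrix.diagonal fun i => (d i)⁻¹) * ((g⁻¹ : GL (Fin n) F) : Matrix (Fin n) (Fin n) F) * Matrix.diagonal d := by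
    rw [_root_.mul_inv_rev, _root_.mul_inv_rev, inv_inv, ← mul_assoc, Units.val_mul, Units.val_mul, hDinv, hD]
  refine ⟨⟨?_, ?_⟩, ?_, ?_⟩
  · rw [e1]; exact key _ _ hg.1.1
  · rw [e2]; exact key _ _ hg.1.2
  · rw [e1, hconj]; exact key _ _ hg.2.1
  · rw [e2, hconj]; exact key _ _ hg.2.2

/-- `|u ϖ^k - u' ϖ^{k'}| = |ϖ^k|` for units `u, u'` and `k < k'`. [folklore] -/
theorem valuation_unit_mul_zpow_sub (hϖ : IsUniformizingElement ϖ) {u u' : F} (hu : valuation F u = 1)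
    (hu' : valuation F u' = 1) {k k' : ℤ} (h : k < k') :
    valuation F (u * ϖ ^ k - u' * ϖ ^ k') = valuation F (ϖ ^ k) := by
  have hlt : valuation F (u' * ϖ ^ k') < valuation F (u * ϖ ^ k) := by
    rw [map_mul, map_mul, hu, hu', one_mul, one_mul]
    obtain ⟨d, hd⟩ := Int.exists_add_of_le (Int.add_one_le_iff.2 h)
    rw [hd, show k + 1 + (d : ℤ) = k + ((d : ℤ) + 1) by ring, zpow_add₀ hϖ.ne_zero, map_mul]
    have h0 : valuation F (ϖ ^ k) ≠ 0 := by rw [ne_eq, map_eq_zero]; exact zpow_ne_zero k hϖ.ne_zero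
    have h1 : valuation F (ϖ ^ ((d : ℤ) + 1)) < 1 := by
      rw [zpow_add₀ hϖ.ne_zero, zpow_one, zpow_natCast, map_mul, map_pow]
      exact (mul_le_mul' (pow_le_one' hϖ.valuation_le_one _) le_rfl).trans_lt (by
        rw [one_mul]; exact hϖ.valuation_lt_one)
    have := mul_lt_mul_of_pos_left h1 (zero_lt_iff.2 h0)
    rwa [mul_one] at this
  rw [Valuation.map_sub_eq_of_lt_left _ hlt, map_mul, hu, one_mul]

/-- `|u ϖ^k - u' ϖ^{k}| = |ϖ^k| |u - u'|`. [folklore] -/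
theorem valuation_unit_mul_zpow_sub_self (k : ℤ) (u u' : F) :
    valuation F (u * ϖ ^ k - u' * ϖ ^ k) = valuation F (ϖ ^ k) * valuation F (u - u') := by
  rw [← sub_mul, map_mul, mul_comm]


/-! ### The scaling rule for integer shells -/

section ScaleZ

variable [IsDiscreteValuationRing 𝒪[F]] [Finite 𝓀[F]]
  (hϖ : IsUniformizingElement ϖ) {Λ : Module.Dual ℂ V} {Φ : V →ₗ⋆[ℂ] V →ₗ[ℂ] ℂ} {t : Fin n} {j : ℕ}
  (hL : IsLevel ρ ψ hϖ.ne_zero Λ Φ t j)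
include hL

/-- **The scaling rule for all integer shells**: `Φ(ρ(ϖ^{k 1_t}) v, ρ(ϖ^{k 1_t}) w) = q^{-jkt} Φ(v, w)`
for every `k ∈ ℤ` (`IsLevel.scale` for `k ≥ 0`, and its inverse for `k < 0`). [folklore] -/
theorem IsLevel.scale_cvecZ (k : ℤ) (v w : V) :
    Φ (ρ (zpowDiagGL hϖ.ne_zero (cvecZ t k)) v) (ρ (zpowDiagGL hϖ.ne_zero (cvecZ t k)) w) =
      (Nat.card 𝓀[F] : ℂ) ^ (-((j : ℤ) * (k * t))) * Φ v w := by
  have hct : ∀ (m : ℕ) i, t ≤ i → cvec t m i = 0 := fun m i hi => by simp [not_lt.2 hi]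
  have hc0 : ∀ (m : ℕ) i, 0 ≤ cvec t m i := fun m i => by simp only [cvec_apply]; split_ifs <;> omega
  rcases le_or_gt 0 k with hk | hk
  · obtain ⟨m, rfl⟩ := Int.eq_ofNat_of_zero_le hk
    rw [cvecZ_natCast, hL.scale (cvec t m) (hct m) (hc0 m), sum_cvec]
  · obtain ⟨m, hm⟩ := Int.eq_ofNat_of_zero_le (neg_nonneg.2 hk.le)
    have hkm : k = -(m : ℤ) := by omega
    have hq : (Nat.card 𝓀[F] : ℂ) ≠ 0 := Nat.cast_ne_zero.2 Nat.card_pos.ne'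
    set d : GL (Fin n) F := zpowDiagGL hϖ.ne_zero (cvec t m) with hd
    have hneg : zpowDiagGL hϖ.ne_zero (cvecZ t k) = d⁻¹ := by
      rw [hkm, cvecZ_neg, cvecZ_natCast, hd, zpowDiagGL_neg]
    have h := hL.scale (cvec t m) (hct m) (hc0 m) (ρ d⁻¹ v) (ρ d⁻¹ w)
    rw [ρ.self_inv_apply, ρ.self_inv_apply, sum_cvec] at h
    rw [hneg, hkm]
    have hz : (Nat.card 𝓀[F] : ℂ) ^ (-((j : ℤ) * ((m : ℤ) * t))) ≠ 0 := zpow_ne_zero _ hq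
    apply mul_left_cancel₀ hz
    rw [← h, ← mul_assoc, ← zpow_add₀ hq, show -((j : ℤ) * ((m : ℤ) * t)) + -((j : ℤ) * (-(m : ℤ) * t)) = 0 by ring,
      zpow_zero, one_mul]


end ScaleZ

/-! ### The one-step Bessel inequality for a vector of finite level -/

section BesselLevel

variable [TopologicalSpace F] [IsNonarchimedeanLocalField F]

variable (hϖ : IsUniformizingElement ϖ) (hψ : ∀ c ∈ 𝒪[F], ψ c = 1) (hψ' : ∃ c ∈ 𝒪[F], ψ (ϖ⁻¹ * c) ≠ 1)
  (hρ : ρ.IsSmooth) {Λ : Module.Dual ℂ V} {Φ : V →ₗ⋆[ℂ] V →ₗ[ℂ] ℂ} {t tp : Fin n} {j : ℕ}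
  (hL : IsLevel ρ ψ hϖ.ne_zero Λ Φ t j) (htp : (tp : ℕ) + 1 = t)
include hϖ hψ hψ' hρ hL htp

/-- **The one-step Bessel inequality at a finite level.** At a level `(Φ, t, j)`, let `ℓ ≥ 1` and let `y`
be fixed by the top-left points of the principal congruence subgroup `K(ℓ) = congruenceGL n |ϖ^ℓ|`.
For every finite set `S ⊂ ℤ` of shells and every finite set `U` of units of `𝒪` pairwise incongruent
modulo `ϖ^ℓ`,
`∑_{k ∈ S} ∑_{u ∈ U} q^{jkt - ℓt} Φ'(ρ(D_u ϖ^{k 1_t}) y, ρ(D_u ϖ^{k 1_t}) y) ≤ Φ(y, y)`, `Φ'` the descended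
form: the pieces `P_{k,u} y` (projectors onto the thin cones `ϖ^{-k}(u e_{t-1} + ϖ^ℓ 𝒪^t)` of the Fourier
variable of `C_t`) are `Φ`-orthogonal self-adjoint idempotents (`sum_re_le_of_orthogonal`);
`D_u ϖ^{k 1_t}` moves `P_{k,u} y` to the central level-`ℓ` projector of `y_{k,u} = ρ(D_u ϖ^{k 1_t}) y` at the
cost `q^{-jkt}` (`IsLevel.scale_cvecZ`, `IsLevel.invTL`), and that projector collapses onto the
approximants of `Φ'` with index `q^{t(N - ℓ)}` against `q^{tN}` (`form_proj_proj_eq_card_mul`: the row shears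
`1 + e_{t-1} ⊗ c̃`, `c̃ ∈ ϖ^ℓ 𝒪^t`, are top-left elements of `K(ℓ)`, which fixes `y_{k,u}`).
[cite: JacquetShalikaAJM1981, §1] -/
theorem IsLevel.bessel_step_level {ℓ : ℕ} (hℓ : 1 ≤ ℓ) {y : V}
    (hy : ∀ g ∈ congruenceGL n (valuation F (ϖ ^ (ℓ : ℤ))), IsTopLeft t (g : Matrix (Fin n) (Fin n) F) → ρ g y = y)
    (S : Finset ℤ) (U : Finset Fˣ) (hU1 : ∀ u ∈ U, valuation F (u : F) = 1)
    (hUsep : ∀ u ∈ U, ∀ u' ∈ U, u ≠ u' → valuation F (ϖ ^ (ℓ : ℤ)) < valuation F ((u : F) - u')) :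
    ∑ k ∈ S, ∑ u ∈ U, (Nat.card 𝓀[F] : ℝ) ^ ((j : ℤ) * k * t - ℓ * t) *
        (descendForm ρ ψ ϖ Φ t tp (ρ (unitDiag tp u * zpowDiagGL hϖ.ne_zero (cvecZ t k)) y)
          (ρ (unitDiag tp u * zpowDiagGL hϖ.ne_zero (cvecZ t k)) y)).re ≤ (Φ y y).re := by
  classical
  have htpt : tp < t := Fin.lt_def.2 (by omega)
  set e : Fin n → F := Pi.single tp 1 with he
  set γ : ValueGroupWithZero F := valuation F (ϖ ^ (ℓ : ℤ)) with hγ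
  have hγ1 : γ < 1 := by
    rw [hγ, zpow_natCast, map_pow]
    exact pow_lt_one' hϖ.valuation_lt_one (by omega)
  -- the pieces, indexed by `p = (k, u)`
  set a : ℤ × Fˣ → Fin n → ℤ := fun p i => -(ℓ : ℤ) - cvecZ t p.1 i with ha
  set b : ℤ × Fˣ → Fin n → F := fun p i => e i * ((p.2 : F) * ϖ ^ p.1) with hb
  -- a common admissible square lattice for `y`
  obtain ⟨M₀, hM₀⟩ := exists_isAdm (ψ := ψ) hϖ t e (hρ y)
  set M : ℤ := max M₀ (max 0 (∑ k ∈ S, |k|)) with hM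
  have hM0 : 0 ≤ M := (le_max_left _ _).trans (le_max_right _ _)
  have hMS : ∀ k ∈ S, |k| ≤ M := fun k hk =>
    ((Finset.single_le_sum (fun k _ => abs_nonneg k) hk).trans (le_max_right _ _)).trans (le_max_right _ _)
  have hAk : ∀ p ∈ S ×ˢ U, IsAdm ρ ψ ϖ t (a p) (fun _ => M) (b p) y := by
    intro p hp
    obtain ⟨hk, hu⟩ := Finset.mem_product.1 hp
    have hkM := hMS p.1 hk
    have habs := neg_abs_le p.1
    have h0 := hM₀ M (le_max_left _ _) (a p) (fun i hi => by
      simp only [ha, cvecZ_apply, if_pos hi]; omega)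
    refine ⟨h0.le, h0.fix, fun i hi => ?_⟩
    simp only [hb, he, mem_zBall_iff]
    by_cases hit : i = tp
    · subst hit
      rw [Pi.single_eq_same, one_mul, map_mul, hU1 _ hu, one_mul]
      exact valuation_zpow_le_of_le hϖ.ne_zero hϖ.valuation_le_one (by
        have := le_abs_self p.1; have := neg_abs_le p.1; omega)
    · rw [Pi.single_eq_of_ne hit, zero_mul, map_zero]; exact zero_le
  set Pc : ℤ × Fˣ → V := fun p => proj ρ ψ ϖ t (a p) (b p) y with hPc
  have hAkP : ∀ p ∈ S ×ˢ U, ∀ p' ∈ S ×ˢ U, IsAdm ρ ψ ϖ t (a p) (fun _ => M) (b p) (Pc p') := fun p hp p' hp' =>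
    (hAk p' hp').of_proj hϖ hψ (hAk p hp).le (hAk p hp).triv
  have hinv : ∀ p, ∀ x ∈ colLat ϖ t (a p), ∀ v' w' : V, Φ (ρ (colElem t x) v') (ρ (colElem t x) w') = Φ v' w' :=
    fun p x _ v' w' => hL.invColF hϖ x v' w'
  -- (i) orthogonality
  have horth_le : ∀ p ∈ S ×ˢ U, ∀ p' ∈ S ×ˢ U, p.1 ≤ p'.1 → p ≠ p' → Φ (Pc p) (Pc p') = 0 := by
    intro p hp p' hp' hle hne
    obtain ⟨-, hu⟩ := Finset.mem_product.1 hp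
    obtain ⟨-, hu'⟩ := Finset.mem_product.1 hp'
    have h21 : ∀ i, i < t → a p' i ≤ a p i := fun i hi => by
      simp only [ha, cvecZ_apply, if_pos hi]; omega
    rw [hPc]
    dsimp only
    rw [form_proj_left_eq_right hϖ hψ Φ (hinv p) (hAk p hp) (hAkP p hp p' hp'),
      proj_proj_eq_zero hϖ hψ hψ' h21 (hAk p' hp') (hAkP p hp p' hp'), map_zero]
    intro H
    have Htp := H tp htpt
    simp only [hb, ha, he, cvecZ_apply, if_pos htpt, Pi.sub_apply, Pi.single_eq_same, one_mul, mem_zBall_iff,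
      neg_sub, sub_neg_eq_add] at Htp
    -- `Htp : |u' ϖ^{k'} - u ϖ^k| ≤ |ϖ^{ℓ + k}|`
    have hlt : valuation F (ϖ ^ (p.1 + (ℓ : ℤ))) < valuation F ((p'.2 : F) * ϖ ^ p'.1 - (p.2 : F) * ϖ ^ p.1) := by
      have hk0 : valuation F (ϖ ^ p.1) ≠ 0 := by rw [ne_eq, map_eq_zero]; exact zpow_ne_zero _ hϖ.ne_zero
      rcases lt_or_eq_of_le hle with hlt | heq
      · rw [Valuation.map_sub_swap, valuation_unit_mul_zpow_sub hϖ (hU1 _ hu) (hU1 _ hu') hlt,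
          zpow_add₀ hϖ.ne_zero, map_mul]
        have := mul_lt_mul_of_pos_left hγ1 (zero_lt_iff.2 hk0)
        rwa [mul_one] at this
      · have hne2 : p.2 ≠ p'.2 := fun h2 => hne (Prod.ext heq h2)
        rw [Valuation.map_sub_swap, ← heq, valuation_unit_mul_zpow_sub_self, zpow_add₀ hϖ.ne_zero, map_mul]
        exact mul_lt_mul_of_pos_left (hUsep _ hu _ hu' hne2) (zero_lt_iff.2 hk0)
    exact absurd Htp (not_le.2 hlt)
  have horth : ∀ p ∈ S ×ˢ U, ∀ p' ∈ S ×ˢ U, p ≠ p' → Φ (Pc p) (Pc p') = 0 := by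
    intro p hp p' hp' hne
    rcases le_or_gt p.1 p'.1 with h | h
    · exact horth_le p hp p' hp' h hne
    · rw [← hL.herm, horth_le p' hp' p hp h.le (Ne.symm hne), map_zero]
  -- (ii) self-adjoint idempotents
  have hproj : ∀ p ∈ S ×ˢ U, Φ (Pc p) y = Φ (Pc p) (Pc p) := by
    intro p hp
    have h1 : Φ y (Pc p) = Φ (Pc p) (Pc p) := by
      rw [hPc]
      dsimp only
      conv_rhs => rw [form_proj_left_eq_right hϖ hψ Φ (hinv p) (hAk p hp) (hAkP p hp p hp),
        proj_idem hϖ hψ (hAk p hp) (hAkP p hp p hp)]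
    rw [← hL.herm y (Pc p), h1, hL.herm]
  rw [← Finset.sum_product (s := S) (t := U) (f := fun p : ℤ × Fˣ => (Nat.card 𝓀[F] : ℝ) ^ ((j : ℤ) * p.1 * t - ℓ * t) *
        (descendForm ρ ψ ϖ Φ t tp (ρ (unitDiag tp p.2 * zpowDiagGL hϖ.ne_zero (cvecZ t p.1)) y)
          (ρ (unitDiag tp p.2 * zpowDiagGL hϖ.ne_zero (cvecZ t p.1)) y)).re)]
  refine le_trans (le_of_eq ?_) (sum_re_le_of_orthogonal Φ hL.herm hL.nonneg (S ×ˢ U) Pc y horth hproj)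
  refine Finset.sum_congr rfl fun p hp => ?_
  obtain ⟨hk, hu⟩ := Finset.mem_product.1 hp
  -- (iii) evaluation of `Φ(P_p y, P_p y)` through the descended form
  set d : GL (Fin n) F := zpowDiagGL hϖ.ne_zero (cvecZ t p.1) with hd
  set D : GL (Fin n) F := unitDiag tp p.2 with hD
  have hDint : D ∈ glInt n F := unitDiag_mem_glInt tp (hU1 _ hu)
  have hDtl : IsTopLeft t ((D : GL (Fin n) F) : Matrix (Fin n) (Fin n) F) := isTopLeft_unitDiag htpt _
  set z : V := ρ (D * d) y with hz
  -- the torus moves the piece to the level-`ℓ` projector at `u e` of `ρ(d) y`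
  have hmove1 : ρ d (Pc p) = proj ρ ψ ϖ t (fun _ => -(ℓ : ℤ)) (Pi.single tp (p.2 : F)) (ρ d y) := by
    have h1 : (fun i => (cvecZ t p.1 i - cvecZ t p.1 t) + a p i) = fun _ => -(ℓ : ℤ) := by
      funext i; simp only [ha, cvecZ_apply, lt_self_iff_false, if_false, sub_zero]; ring
    have h2 : (fun i => b p i * ϖ ^ (-(cvecZ t p.1 i - cvecZ t p.1 t))) = Pi.single tp (p.2 : F) := by
      funext i
      simp only [hb, he, cvecZ_apply, lt_self_iff_false, if_false, sub_zero]
      by_cases hit : i = tp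
      · subst hit
        rw [Pi.single_eq_same, Pi.single_eq_same, if_pos htpt, one_mul, mul_assoc, ← zpow_add₀ hϖ.ne_zero,
          add_neg_cancel, zpow_zero, mul_one]
      · rw [Pi.single_eq_of_ne hit, Pi.single_eq_of_ne hit, zero_mul, zero_mul]
    rw [hPc]; dsimp only
    rw [hd, apply_zpowDiagGL_proj hϖ hψ (cvecZ t p.1) (hAk p hp), h1, h2]
  -- the unit twist moves it to the standard character of `z`
  obtain ⟨M₁, hM₁⟩ := exists_isAdm (ψ := ψ) hϖ t (Pi.single tp (p.2 : F)) (hρ (ρ d y))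
  have hmove2 : ρ D (proj ρ ψ ϖ t (fun _ => -(ℓ : ℤ)) (Pi.single tp (p.2 : F)) (ρ d y)) =
      proj ρ ψ ϖ t (fun _ => -(ℓ : ℤ)) e z := by
    have hA := hM₁ (max M₁ 0) (le_max_left _ _) (fun _ => -(ℓ : ℤ)) (fun _ _ => by
      have := le_max_right M₁ 0; omega)
    rw [hD, apply_glInt_proj hϖ hψ hDint hDtl hA, single_vecMul_unitDiag_inv, Units.mul_inv, ← he, hz, hD,
      map_mul, Module.End.mul_apply]
  have hmove : ρ (D * d) (Pc p) = proj ρ ψ ϖ t (fun _ => -(ℓ : ℤ)) e z := by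
    rw [map_mul, Module.End.mul_apply, hmove1, hmove2]
  -- `z` is again fixed by the top-left points of `K(ℓ)`
  have hzk : ∀ g ∈ congruenceGL n γ, IsTopLeft t (g : Matrix (Fin n) (Fin n) F) → ρ g z = z := by
    intro g hg hgt
    have hg' : D⁻¹ * g * D ∈ congruenceGL n γ := unitDiag_inv_mul_mul_mem_congruenceGL (hU1 _ hu) hg
    have hgt' : IsTopLeft t (((D⁻¹ * g * D : GL (Fin n) F)) : Matrix (Fin n) (Fin n) F) := by
      rw [Units.val_mul, Units.val_mul]
      exact ((IsTopLeft.inv hDtl).mul hgt).mul hDtl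
    have hcomm : (D⁻¹ * g * D) * d = d * (D⁻¹ * g * D) := zpowDiagGL_cvecZ_comm hϖ.ne_zero p.1 hgt'
    have : g * (D * d) = (D * d) * (D⁻¹ * g * D) := by
      rw [mul_assoc D d, ← hcomm]; group
    rw [hz, ← Module.End.mul_apply, ← map_mul, this, map_mul, Module.End.mul_apply, hy _ hg' hgt']
  -- thresholds for `z` and the value of the descended form
  obtain ⟨M', N₁, hM'0, hN1, hA', -⟩ := exists_thresholds (ψ := ψ) (t := t) (tp := tp) hϖ hρ z z
  obtain ⟨N₀, hN₀⟩ := descendForm_eq₂ hϖ hψ hψ' hρ hL htp z z z z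
  set N' : ℕ := max N₀ ℓ with hN'
  have hN'ℓ : (ℓ : ℤ) ≤ N' := by rw [hN']; exact_mod_cast le_max_right _ _
  have hAstar : IsAdm ρ ψ ϖ t (fun _ => -(ℓ : ℤ)) (fun _ => M') e z :=
    (hA' (fun _ => -(ℓ : ℤ)) fun i _ => by omega).1
  haveI : Fintype (LQ ϖ t (-fun _ : Fin n => -(ℓ : ℤ)) (-fun _ : Fin n => -(N' : ℤ))) :=
    @Fintype.ofFinite _ (finite_colLat_quotient hϖ t fun i _ => by simp only [Pi.neg_apply]; omega)
  have hcoll := form_proj_proj_eq_card_mul hϖ hψ hψ' hL htp (a := fun _ => -(ℓ : ℤ)) (s := -(N' : ℤ)) (M := M')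
    (fun i _ => by omega) (fun _ _ => by omega) (by omega) hAstar hAstar (by omega) hM'0 (fun x hx h => ?_)
  swap
  · -- the row shears `1 + e_{tp} ⊗ c̃`, `c̃ ∈ ϖ^ℓ 𝒪^t`, lie in `K(ℓ)`, are top-left, and fix `z`
    have hq : ∀ i, valuation F (x i) ≤ γ := by
      intro i
      by_cases hi : i < t
      · have := mem_zBall_iff.1 (hx.1 i hi)
        simpa only [Pi.neg_apply, neg_neg] using this
      · rw [hx.2 i hi, map_zero]; exact zero_le
    have hmem : rowShear tp x h ∈ congruenceGL n γ := rowShear_mem_congruenceGL hγ1 hq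
    have hfix := hzk _ hmem (isTopLeft_rowShear' htpt (fun i hi => hx.2 i (not_lt.2 hi)) h)
    exact ⟨hfix, hfix⟩
  -- the index `[ϖ^ℓ 𝒪^t : ϖ^{N'} 𝒪^t] = q^{t(N' - ℓ)}`
  have hcard : Fintype.card (LQ ϖ t (-fun _ : Fin n => -(ℓ : ℤ)) (-fun _ : Fin n => -(N' : ℤ))) =
      Nat.card 𝓀[F] ^ ((t : ℕ) * ((N' : ℤ) - ℓ).toNat) := by
    rw [← Nat.card_eq_fintype_card,
      show Nat.card (LQ ϖ t (-fun _ : Fin n => -(ℓ : ℤ)) (-fun _ : Fin n => -(N' : ℤ))) = _ from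
        natCard_colLat_quotient hϖ t (fun i _ => by simp only [Pi.neg_apply]; omega)]
    congr 1
    simp only [Pi.neg_apply, neg_neg, Finset.sum_const, Finset.card_univ, card_subtype_lt, smul_eq_mul]
  have hE : (((t : ℕ) * ((N' : ℤ) - ℓ).toNat : ℕ) : ℤ) = (t : ℤ) * N' - t * ℓ := by
    push_cast
    rw [Int.toNat_of_nonneg (by omega)]
    ring
  -- assemble: `Φ(P_p y, P_p y) = q^{jkt - ℓt} Φ'(z, z)`
  have hqne : (Nat.card 𝓀[F] : ℂ) ≠ 0 := Nat.cast_ne_zero.2 Nat.card_pos.ne'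
  have hval : Φ (Pc p) (Pc p) = (Nat.card 𝓀[F] : ℂ) ^ ((j : ℤ) * p.1 * t - ℓ * t) * descendForm ρ ψ ϖ Φ t tp z z := by
    -- transport by `D d`
    have h1 : Φ (Pc p) (Pc p) = (Nat.card 𝓀[F] : ℂ) ^ ((j : ℤ) * (p.1 * t)) * Φ (ρ (D * d) (Pc p)) (ρ (D * d) (Pc p)) := by
      rw [map_mul, Module.End.mul_apply, hL.invTL D hDint hDtl, hL.scale_cvecZ hϖ p.1, ← mul_assoc, ← zpow_add₀ hqne,
        add_neg_cancel, zpow_zero, one_mul]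
    have hcardC : ((Fintype.card (LQ ϖ t (-fun _ : Fin n => -(ℓ : ℤ)) (-fun _ : Fin n => -(N' : ℤ))) : ℕ) : ℂ) =
        (Nat.card 𝓀[F] : ℂ) ^ ((t : ℤ) * N' - t * ℓ) := by
      rw [hcard, Nat.cast_pow, ← zpow_natCast, hE]
    have hds : (Nat.card 𝓀[F] : ℂ) ^ ((N' : ℕ) * (t : ℕ) : ℕ) = (Nat.card 𝓀[F] : ℂ) ^ ((N' : ℤ) * t) := by
      rw [← zpow_natCast]; push_cast; ring_nf
    rw [h1, hmove, hcoll, (hN₀ N' (le_max_left _ _)).1, dStep, ← he, hcardC, hds]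
    simp only [← mul_assoc, ← zpow_add₀ hqne]
    congr 2
    ring
  rw [hval]
  have hqR : ((Nat.card 𝓀[F] : ℂ)) = ((Nat.card 𝓀[F] : ℝ) : ℂ) := by push_cast; rfl
  rw [show (Nat.card 𝓀[F] : ℂ) ^ ((j : ℤ) * p.1 * t - ℓ * t) = (((Nat.card 𝓀[F] : ℝ) ^ ((j : ℤ) * p.1 * t - ℓ * t) : ℝ) : ℂ) by
      rw [hqR]; push_cast; rfl,
    Complex.re_ofReal_mul]

end BesselLevel


/-! ### The chain inequality and the Bessel bound for a vector of finite level -/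

section ChainLevel

open scoped ComplexConjugate

variable {m : ℕ} {ρ : Representation ℂ (GL (Fin (m + 1)) F) V}

omit [ValuativeRel F] in
/-- **The torus weight on integer exponents** `w(λ) = ∑_i λ_i (m - 1 - 2i)` (the exponent of the Iwasawa
Jacobian `δ_{B_m}⁻¹(ϖ^λ)` on `GL_m`; `wt` on `ℕ`-exponents). [folklore] -/
def wtZ (m : ℕ) (la : Fin (m + 1) → ℤ) : ℤ := ∑ i, la i * ((m : ℤ) - 1 - 2 * (i : ℕ))

omit [ValuativeRel F] in
/-- The **triangular numbers** `tri r = r (r + 1) / 2 = 1 + 2 + ⋯ + r` (recursive form). [folklore] -/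
def tri : ℕ → ℕ
  | 0 => 0
  | r + 1 => tri r + (r + 1)

omit [ValuativeRel F] in
/-- `2 · tri r = r (r + 1)`. [folklore] -/
theorem two_mul_tri (r : ℕ) : 2 * tri r = r * (r + 1) := by
  induction r with
  | zero => rfl
  | succ r ih => rw [tri, mul_add, ih]; ring

omit [ValuativeRel F] in
/-- **The torus element** `ϖ^λ D_μ = diag(ϖ^{λ_i} μ_i)`. [folklore] -/
def torusElem (hϖ0 : ϖ ≠ 0) (la : Fin (m + 1) → ℤ) (mu : Fin (m + 1) → Fˣ) : GL (Fin (m + 1)) F :=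
  zpowDiagGL hϖ0 la * diagonalGL (Fin (m + 1)) F mu

omit [ValuativeRel F] in
/-- `ϖ^λ` is the image of `i ↦ ϖ^{λ_i}` under `diagonalGL`. [folklore] -/
theorem zpowDiagGL_eq_diagonalGL (hϖ0 : ϖ ≠ 0) (la : Fin (m + 1) → ℤ) :
    zpowDiagGL hϖ0 la = diagonalGL (Fin (m + 1)) F (fun i => Units.mk0 ϖ hϖ0 ^ la i) := rfl

omit [ValuativeRel F] in
/-- Multiplicativity of the torus elements (the torus is commutative). [folklore] -/
theorem torusElem_add_mul (hϖ0 : ϖ ≠ 0) (la la' : Fin (m + 1) → ℤ) (mu mu' : Fin (m + 1) → Fˣ) :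
    torusElem hϖ0 (la + la') (mu * mu') = torusElem hϖ0 la mu * torusElem hϖ0 la' mu' := by
  simp only [torusElem, zpowDiagGL_eq_diagonalGL, ← map_mul]
  congr 1
  funext i
  simp only [Pi.mul_apply, Pi.add_apply, _root_.zpow_add]
  rw [mul_mul_mul_comm]

omit [ValuativeRel F] in
/-- The torus element of a single shell and a single unit: `ϖ^{a 1_t} D_u = D_u ϖ^{a 1_t}`. [folklore] -/
theorem torusElem_cvecZ_mulSingle (hϖ0 : ϖ ≠ 0) (t tp : Fin (m + 1)) (a : ℤ) (u : Fˣ) :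
    torusElem hϖ0 (cvecZ t a) (Pi.mulSingle tp u) = unitDiag tp u * zpowDiagGL hϖ0 (cvecZ t a) := by
  rw [torusElem, unitDiag_mul_zpowDiagGL_comm]; rfl

omit [ValuativeRel F] in
/-- The trivial torus element. [folklore] -/
theorem torusElem_zero_one (hϖ0 : ϖ ≠ 0) : torusElem hϖ0 (0 : Fin (m + 1) → ℤ) (1 : Fin (m + 1) → Fˣ) = 1 := by
  rw [torusElem, zpowDiagGL_zero, map_one, one_mul]

variable [TopologicalSpace F] [IsNonarchimedeanLocalField F] {ψ : AddChar F Circle}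
  (hϖ : IsUniformizingElement ϖ) (hψ : ∀ c ∈ 𝒪[F], ψ c = 1) (hψ' : ∃ c ∈ 𝒪[F], ψ (ϖ⁻¹ * c) ≠ 1)
  (hρ : ρ.IsSmooth) {Λ : Module.Dual ℂ V} {B : V →ₗ⋆[ℂ] V →ₗ[ℂ] ℂ}
  (hLev : ∀ k, k ≤ m → IsLevel ρ ψ hϖ.ne_zero Λ (levelForm ρ ψ ϖ B k) (col m k) k)
  {ℓ : ℕ} (hℓ : 1 ≤ ℓ) {U : Finset Fˣ} (hU1 : ∀ u ∈ U, valuation F (u : F) = 1)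
  (hUsep : ∀ u ∈ U, ∀ u' ∈ U, u ≠ u' → valuation F (ϖ ^ (ℓ : ℤ)) < valuation F ((u : F) - u'))
include hϖ hψ hψ' hρ hLev hℓ hU1 hUsep

/-- **The chain inequality at a finite level.** For `r ≤ m`, `y` fixed by the top-left points of size
`r` of `K(ℓ)`, and any finite set `T` of pairs `(λ, μ)` of integer exponents and units supported in the rows
`< r` (`λ_i = 0`, `μ_i = 1` for `i ≥ r`; `μ_i ∈ U` for `i < r`),
`∑_{(λ,μ) ∈ T} q^{w(λ)} q^{-ℓ (1 + ⋯ + r)} Φ_m(ρ(ϖ^λ D_μ) y, ρ(ϖ^λ D_μ) y) ≤ Φ_{m-r}(y, y)`: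
partition `T` by the last active pair `(a, u) = (λ_{r-1}, μ_{r-1})`, peel it off
(`λ = λ' + a 1_{<r}`, `μ = μ' · u_{(r-1)}`, `w(λ) = w(λ') + a r (m - r)` by `gauss_sum`), apply the statement
for `r - 1` to `ρ(D_u ϖ^{a 1_{<r}}) y` and then `IsLevel.bessel_step_level` at the level `m - r`.
[cite: JacquetShalikaAJM1981, §1] -/
theorem chain_level {r : ℕ} (hr : r ≤ m) {y : V}
    (hy : ∀ g ∈ congruenceGL (m + 1) (valuation F (ϖ ^ (ℓ : ℤ))),
      IsTopLeft (col m (m - r)) (g : Matrix (Fin (m + 1)) (Fin (m + 1)) F) → ρ g y = y)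
    (T : Finset ((Fin (m + 1) → ℤ) × (Fin (m + 1) → Fˣ)))
    (hT : ∀ p ∈ T, (∀ i : Fin (m + 1), r ≤ (i : ℕ) → p.1 i = 0 ∧ p.2 i = 1) ∧
      ∀ i : Fin (m + 1), (i : ℕ) < r → p.2 i ∈ U) :
    ∑ p ∈ T, (Nat.card 𝓀[F] : ℝ) ^ (wtZ m p.1) * ((Nat.card 𝓀[F] : ℝ))⁻¹ ^ (ℓ * tri r) *
        ((levelForm ρ ψ ϖ B m) (ρ (torusElem hϖ.ne_zero p.1 p.2) y) (ρ (torusElem hϖ.ne_zero p.1 p.2) y)).re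
      ≤ ((levelForm ρ ψ ϖ B (m - r)) y y).re := by
  classical
  induction r generalizing y T with
  | zero =>
    -- `T ⊆ {(0, 1)}`
    have hLm := hLev m le_rfl
    have hT0 : ∀ p ∈ T, p = (0, 1) := fun p hp =>
      Prod.ext (funext fun i => ((hT p hp).1 i (Nat.zero_le _)).1) (funext fun i => ((hT p hp).1 i (Nat.zero_le _)).2)
    have hsub : T ⊆ {((0 : Fin (m + 1) → ℤ), (1 : Fin (m + 1) → Fˣ))} := fun p hp => by
      rw [Finset.mem_singleton]; exact hT0 p hp
    refine le_trans (Finset.sum_le_sum_of_subset_of_nonneg hsub fun p _ _ => ?_) ?_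
    · exact mul_nonneg (mul_nonneg (zpow_nonneg (Nat.cast_nonneg _) _) (pow_nonneg (inv_nonneg.2 (Nat.cast_nonneg _)) _))
        (hLm.nonneg _)
    · rw [Finset.sum_singleton, Nat.sub_zero]
      simp only [wtZ, Pi.zero_apply, zero_mul, Finset.sum_const_zero, zpow_zero, tri, mul_zero, pow_zero, one_mul]
      rw [torusElem_zero_one, map_one, Module.End.one_apply]
  | succ r ih =>
    -- the level `k = m - (r+1)`, its column `t` (value `r+1`) and the next column `tp` (value `r`)
    set k : ℕ := m - (r + 1) with hk
    have hk1 : k + 1 = m - r := by omega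
    have hkm : k ≤ m := by omega
    have htval : ((col m k : Fin (m + 1)) : ℕ) = r + 1 := by rw [col_val]; omega
    have htpval : ((col m (k + 1) : Fin (m + 1)) : ℕ) = r := by rw [col_val]; omega
    have htp : ((col m (k + 1) : Fin (m + 1)) : ℕ) + 1 = (col m k : Fin (m + 1)) := by omega
    have hL := hLev k hkm
    have hlt_iff : ∀ i : Fin (m + 1), i < col m k ↔ (i : ℕ) < r + 1 := fun i => by rw [Fin.lt_def, htval]
    set rF : Fin (m + 1) := col m (k + 1) with hrF
    have hrFval : (rF : ℕ) = r := htpval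
    set q : ℝ := (Nat.card 𝓀[F] : ℝ) with hq
    have hq0 : q ≠ 0 := Nat.cast_ne_zero.2 Nat.card_pos.ne'
    have hqnn : 0 ≤ q := Nat.cast_nonneg _
    -- peeling off the last active pair `(a, u) = (λ_r, μ_r)`
    set key : ((Fin (m + 1) → ℤ) × (Fin (m + 1) → Fˣ)) → ℤ × Fˣ := fun p => (p.1 rF, p.2 rF) with hkey
    set sub : ((Fin (m + 1) → ℤ) × (Fin (m + 1) → Fˣ)) → ((Fin (m + 1) → ℤ) × (Fin (m + 1) → Fˣ)) := fun p =>
      (fun i => if (i : ℕ) ≤ r then p.1 i - p.1 rF else p.1 i, fun i => if i = rF then 1 else p.2 i) with hsub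
    have hpeel : ∀ p ∈ T, (p.1 = (sub p).1 + cvecZ (col m k) (p.1 rF)) ∧ (p.2 = (sub p).2 * Pi.mulSingle rF (p.2 rF)) ∧
        ((∀ i : Fin (m + 1), r ≤ (i : ℕ) → (sub p).1 i = 0 ∧ (sub p).2 i = 1) ∧
          ∀ i : Fin (m + 1), (i : ℕ) < r → (sub p).2 i ∈ U) := by
      intro p hp
      obtain ⟨hsupp, hU⟩ := hT p hp
      refine ⟨funext fun i => ?_, funext fun i => ?_, fun i hi => ⟨?_, ?_⟩, fun i hi => ?_⟩
      · simp only [hsub, Pi.add_apply, cvecZ_apply, hlt_iff]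
        by_cases hi : (i : ℕ) ≤ r
        · rw [if_pos hi, if_pos (by omega)]; ring
        · rw [if_neg hi, if_neg (by omega), add_zero]
      · simp only [hsub, Pi.mul_apply]
        by_cases hi : i = rF
        · subst hi; rw [if_pos rfl, Pi.mulSingle_eq_same, one_mul]
        · rw [if_neg hi, Pi.mulSingle_eq_of_ne hi, mul_one]
      · simp only [hsub]
        by_cases hi' : (i : ℕ) ≤ r
        · have : i = rF := Fin.ext (by omega)
          rw [if_pos hi', this, sub_self]
        · rw [if_neg hi']; exact (hsupp i (by omega)).1
      · simp only [hsub]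
        by_cases hi' : i = rF
        · rw [if_pos hi']
        · rw [if_neg hi']
          exact (hsupp i (by
            have : (i : ℕ) ≠ r := fun e => hi' (Fin.ext (by omega))
            omega)).2
      · simp only [hsub]
        have : i ≠ rF := fun e => by rw [e] at hi; omega
        rw [if_neg this]
        exact hU i (by omega)
    have hinj : ∀ c, Set.InjOn sub (T.filter fun p => key p = c) := by
      intro c p₁ h₁ p₂ h₂ h12
      rw [Finset.coe_filter, Set.mem_setOf_eq] at h₁ h₂
      have hk12 : key p₁ = key p₂ := h₁.2.trans h₂.2.symm
      simp only [hkey, Prod.mk.injEq] at hk12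
      have h1 := congrArg Prod.fst h12
      have h2 := congrArg Prod.snd h12
      refine Prod.ext (funext fun i => ?_) (funext fun i => ?_)
      · have := congrFun h1 i
        simp only [hsub] at this
        by_cases hi : (i : ℕ) ≤ r
        · rw [if_pos hi, if_pos hi, hk12.1] at this; omega
        · rwa [if_neg hi, if_neg hi] at this
      · have := congrFun h2 i
        simp only [hsub] at this
        by_cases hi : i = rF
        · rw [hi]; exact hk12.2
        · rwa [if_neg hi, if_neg hi] at this
    have hz : ∀ p ∈ T, torusElem hϖ.ne_zero p.1 p.2 =
        torusElem hϖ.ne_zero (sub p).1 (sub p).2 * (unitDiag rF (p.2 rF) * zpowDiagGL hϖ.ne_zero (cvecZ (col m k) (p.1 rF))) := by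
      intro p hp
      rw [← torusElem_cvecZ_mulSingle, ← torusElem_add_mul, ← (hpeel p hp).1, ← (hpeel p hp).2.1]
    have hwt : ∀ p ∈ T, wtZ m p.1 = wtZ m (sub p).1 + (k : ℤ) * (p.1 rF) * (r + 1) := by
      intro p hp
      have h1 : wtZ m p.1 = ∑ i, ((sub p).1 i + cvecZ (col m k) (p.1 rF) i) * ((m : ℤ) - 1 - 2 * (i : ℕ)) := by
        rw [wtZ]; exact Finset.sum_congr rfl fun i _ => by rw [← Pi.add_apply, ← (hpeel p hp).1]
      rw [h1, wtZ]
      simp only [add_mul, Finset.sum_add_distrib, cvecZ_apply, hlt_iff, ite_mul, zero_mul]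
      congr 1
      rw [Finset.sum_ite, Finset.sum_const_zero, add_zero, ← Finset.mul_sum, gauss_sum (r + 1) (by omega)]
      push_cast
      rw [hk, Nat.cast_sub (by omega)]
      push_cast
      ring
    -- the vectors `y_{a,u} = ρ(D_u ϖ^{a 1_{<r+1}}) y` are again fixed by the top-left points of size `r` of `K(ℓ)`
    have hya : ∀ (a : ℤ) (u : Fˣ), u ∈ U → ∀ g ∈ congruenceGL (m + 1) (valuation F (ϖ ^ (ℓ : ℤ))),
        IsTopLeft (col m (m - r)) (g : Matrix (Fin (m + 1)) (Fin (m + 1)) F) →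
        ρ g (ρ (unitDiag rF u * zpowDiagGL hϖ.ne_zero (cvecZ (col m k) a)) y) =
          ρ (unitDiag rF u * zpowDiagGL hϖ.ne_zero (cvecZ (col m k) a)) y := by
      intro a u hu g hg hgt
      rw [← hk1] at hgt
      have hgt' : IsTopLeft (col m k) (g : Matrix (Fin (m + 1)) (Fin (m + 1)) F) :=
        IsTopLeft.of_le hgt (Fin.le_def.2 (by omega))
      set D : GL (Fin (m + 1)) F := unitDiag rF u with hD
      have hDtl : IsTopLeft (col m k) ((D : GL (Fin (m + 1)) F) : Matrix (Fin (m + 1)) (Fin (m + 1)) F) :=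
        isTopLeft_unitDiag (Fin.lt_def.2 (by omega)) _
      have hg' : D⁻¹ * g * D ∈ congruenceGL (m + 1) (valuation F (ϖ ^ (ℓ : ℤ))) :=
        unitDiag_inv_mul_mul_mem_congruenceGL (hU1 _ hu) hg
      have hgt'' : IsTopLeft (col m k) (((D⁻¹ * g * D : GL (Fin (m + 1)) F)) : Matrix (Fin (m + 1)) (Fin (m + 1)) F) := by
        rw [Units.val_mul, Units.val_mul]
        exact ((IsTopLeft.inv hDtl).mul hgt').mul hDtl
      have hcomm := zpowDiagGL_cvecZ_comm hϖ.ne_zero a hgt''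
      have : g * (D * zpowDiagGL hϖ.ne_zero (cvecZ (col m k) a)) =
          (D * zpowDiagGL hϖ.ne_zero (cvecZ (col m k) a)) * (D⁻¹ * g * D) := by
        rw [mul_assoc D, ← hcomm]; group
      rw [← Module.End.mul_apply, ← map_mul, this, map_mul, Module.End.mul_apply, hy _ hg' hgt'']
    -- the coefficient of the peeled pair
    have hcoef : ∀ p ∈ T, q ^ (wtZ m p.1) * q⁻¹ ^ (ℓ * tri (r + 1)) =
        (q ^ ((k : ℤ) * (p.1 rF) * ((col m k : Fin (m + 1)) : ℕ) - ℓ * ((col m k : Fin (m + 1)) : ℕ))) *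
          (q ^ (wtZ m (sub p).1) * q⁻¹ ^ (ℓ * tri r)) := by
      intro p hp
      rw [hwt p hp, tri, htval, zpow_add₀ hq0, zpow_sub₀ hq0, mul_add ℓ, pow_add, inv_pow, inv_pow, ← zpow_natCast q (ℓ * (r + 1))]
      push_cast
      ring
    -- termwise rewriting
    have hterm : ∀ p ∈ T,
        q ^ (wtZ m p.1) * q⁻¹ ^ (ℓ * tri (r + 1)) *
          ((levelForm ρ ψ ϖ B m) (ρ (torusElem hϖ.ne_zero p.1 p.2) y) (ρ (torusElem hϖ.ne_zero p.1 p.2) y)).re =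
        q ^ ((k : ℤ) * (p.1 rF) * ((col m k : Fin (m + 1)) : ℕ) - ℓ * ((col m k : Fin (m + 1)) : ℕ)) *
          (q ^ (wtZ m (sub p).1) * q⁻¹ ^ (ℓ * tri r) *
            ((levelForm ρ ψ ϖ B m)
              (ρ (torusElem hϖ.ne_zero (sub p).1 (sub p).2)
                (ρ (unitDiag rF (p.2 rF) * zpowDiagGL hϖ.ne_zero (cvecZ (col m k) (p.1 rF))) y))
              (ρ (torusElem hϖ.ne_zero (sub p).1 (sub p).2)
                (ρ (unitDiag rF (p.2 rF) * zpowDiagGL hϖ.ne_zero (cvecZ (col m k) (p.1 rF))) y))).re) := by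
      intro p hp
      rw [hz p hp, map_mul, Module.End.mul_apply, hcoef p hp]
      ring
    -- the fibre index set lies in `S ×ˢ U`
    set S : Finset ℤ := T.image fun p => p.1 rF with hS
    have hkeyU : ∀ p ∈ T, p.2 rF ∈ U := fun p hp => (hT p hp).2 rF (by omega)
    have hsubset : T.image key ⊆ S ×ˢ U := by
      intro c hc
      obtain ⟨p, hp, rfl⟩ := Finset.mem_image.1 hc
      exact Finset.mem_product.2 ⟨Finset.mem_image_of_mem _ hp, hkeyU p hp⟩
    -- assemble
    calc ∑ p ∈ T, q ^ (wtZ m p.1) * q⁻¹ ^ (ℓ * tri (r + 1)) *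
          ((levelForm ρ ψ ϖ B m) (ρ (torusElem hϖ.ne_zero p.1 p.2) y) (ρ (torusElem hϖ.ne_zero p.1 p.2) y)).re
        = ∑ c ∈ T.image key, ∑ p ∈ T.filter (fun p => key p = c),
            q ^ ((k : ℤ) * c.1 * ((col m k : Fin (m + 1)) : ℕ) - ℓ * ((col m k : Fin (m + 1)) : ℕ)) *
              (q ^ (wtZ m (sub p).1) * q⁻¹ ^ (ℓ * tri r) *
                ((levelForm ρ ψ ϖ B m)
                  (ρ (torusElem hϖ.ne_zero (sub p).1 (sub p).2)
                    (ρ (unitDiag rF c.2 * zpowDiagGL hϖ.ne_zero (cvecZ (col m k) c.1)) y))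
                  (ρ (torusElem hϖ.ne_zero (sub p).1 (sub p).2)
                    (ρ (unitDiag rF c.2 * zpowDiagGL hϖ.ne_zero (cvecZ (col m k) c.1)) y))).re) := by
          rw [← Finset.sum_fiberwise_of_maps_to (fun p hp => Finset.mem_image_of_mem key hp)]
          refine Finset.sum_congr rfl fun c _ => Finset.sum_congr rfl fun p hp => ?_
          rw [Finset.mem_filter] at hp
          rw [hterm p hp.1, ← hp.2]
      _ = ∑ c ∈ T.image key, q ^ ((k : ℤ) * c.1 * ((col m k : Fin (m + 1)) : ℕ) - ℓ * ((col m k : Fin (m + 1)) : ℕ)) *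
            ∑ p' ∈ (T.filter (fun p => key p = c)).image sub,
              q ^ (wtZ m p'.1) * q⁻¹ ^ (ℓ * tri r) *
                ((levelForm ρ ψ ϖ B m)
                  (ρ (torusElem hϖ.ne_zero p'.1 p'.2) (ρ (unitDiag rF c.2 * zpowDiagGL hϖ.ne_zero (cvecZ (col m k) c.1)) y))
                  (ρ (torusElem hϖ.ne_zero p'.1 p'.2) (ρ (unitDiag rF c.2 * zpowDiagGL hϖ.ne_zero (cvecZ (col m k) c.1)) y))).re := by
          refine Finset.sum_congr rfl fun c _ => ?_
          rw [Finset.mul_sum, Finset.sum_image (hinj c)]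
      _ ≤ ∑ c ∈ T.image key, q ^ ((k : ℤ) * c.1 * ((col m k : Fin (m + 1)) : ℕ) - ℓ * ((col m k : Fin (m + 1)) : ℕ)) *
            ((levelForm ρ ψ ϖ B (k + 1)) (ρ (unitDiag rF c.2 * zpowDiagGL hϖ.ne_zero (cvecZ (col m k) c.1)) y)
              (ρ (unitDiag rF c.2 * zpowDiagGL hϖ.ne_zero (cvecZ (col m k) c.1)) y)).re := by
          refine Finset.sum_le_sum fun c hc => mul_le_mul_of_nonneg_left ?_ (zpow_nonneg hqnn _)
          obtain ⟨p₀, hp₀, rfl⟩ := Finset.mem_image.1 hc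
          rw [hk1]
          refine ih (by omega) (hya _ _ (hkeyU p₀ hp₀)) _ fun p' hp' => ?_
          obtain ⟨p, hp, rfl⟩ := Finset.mem_image.1 hp'
          exact (hpeel p (Finset.mem_filter.1 hp).1).2.2
      _ ≤ ∑ c ∈ S ×ˢ U, q ^ ((k : ℤ) * c.1 * ((col m k : Fin (m + 1)) : ℕ) - ℓ * ((col m k : Fin (m + 1)) : ℕ)) *
            ((levelForm ρ ψ ϖ B (k + 1)) (ρ (unitDiag rF c.2 * zpowDiagGL hϖ.ne_zero (cvecZ (col m k) c.1)) y)
              (ρ (unitDiag rF c.2 * zpowDiagGL hϖ.ne_zero (cvecZ (col m k) c.1)) y)).re := by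
          refine Finset.sum_le_sum_of_subset_of_nonneg hsubset fun c _ _ => mul_nonneg (zpow_nonneg hqnn _) ?_
          rw [hk1]
          exact (hLev (m - r) (by omega)).nonneg _
      _ = ∑ a ∈ S, ∑ u ∈ U, q ^ ((k : ℤ) * a * ((col m k : Fin (m + 1)) : ℕ) - ℓ * ((col m k : Fin (m + 1)) : ℕ)) *
            (descendForm ρ ψ ϖ (levelForm ρ ψ ϖ B k) (col m k) (col m (k + 1))
              (ρ (unitDiag rF u * zpowDiagGL hϖ.ne_zero (cvecZ (col m k) a)) y)
              (ρ (unitDiag rF u * zpowDiagGL hϖ.ne_zero (cvecZ (col m k) a)) y)).re := by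
          rw [Finset.sum_product, levelForm_succ]
      _ ≤ ((levelForm ρ ψ ϖ B k) y y).re :=
          hL.bessel_step_level hϖ hψ hψ' hρ htp hℓ hy S U hU1 hUsep

/-- **The Bessel bound for a vector of finite level**: for `v` fixed by the principal congruence subgroup
`K(ℓ)`, `ℓ ≥ 1`, and every finite set `T` of pairs `(λ, μ)` of integer exponents with `λ_m = 0` and unit
tuples with `μ_m = 1`, `μ_i ∈ U` (`i < m`),
`∑_{(λ,μ) ∈ T} q^{w(λ)} q^{-ℓ m(m+1)/2} Φ_m(ρ(ϖ^λ D_μ) v, ρ(ϖ^λ D_μ) v) ≤ B(v, v)` (`chain_level` with `r = m`).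
[cite: JacquetShalikaAJM1981, §1] -/
theorem bessel_bound_level {v : V} (hv : ∀ g ∈ congruenceGL (m + 1) (valuation F (ϖ ^ (ℓ : ℤ))), ρ g v = v)
    (T : Finset ((Fin (m + 1) → ℤ) × (Fin (m + 1) → Fˣ)))
    (hT : ∀ p ∈ T, (p.1 (Fin.last m) = 0 ∧ p.2 (Fin.last m) = 1) ∧ ∀ i : Fin (m + 1), (i : ℕ) < m → p.2 i ∈ U) :
    ∑ p ∈ T, (Nat.card 𝓀[F] : ℝ) ^ (wtZ m p.1) * ((Nat.card 𝓀[F] : ℝ))⁻¹ ^ (ℓ * tri m) *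
        ((levelForm ρ ψ ϖ B m) (ρ (torusElem hϖ.ne_zero p.1 p.2) v) (ρ (torusElem hϖ.ne_zero p.1 p.2) v)).re
      ≤ (B v v).re := by
  have := chain_level hϖ hψ hψ' hρ hLev hℓ hU1 hUsep (le_refl m) (y := v) (fun g hg _ => hv g hg) T fun p hp =>
    ⟨fun i hi => by
      have : i = Fin.last m := Fin.ext (by have := i.2; rw [Fin.val_last]; omega)
      rw [this]; exact (hT p hp).1, (hT p hp).2⟩
  rwa [Nat.sub_self] at this

end ChainLevel


/-! ### The tower from a positive semi-definite invariant form -/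

section PsdTower

open scoped ComplexConjugate

variable {m : ℕ} {ρ : Representation ℂ (GL (Fin (m + 1)) F) V} {ψ : AddChar F Circle}

/-- **Level zero for a positive semi-definite form**: an invariant Hermitian positive semi-definite form `B`
with `B(v, v) = 0 ⇒ Λ v = 0` is a level structure at the last column with weight `0` (the hypothesis
actually used by the descent; `isLevel_zero` is the positive-definite case). [folklore] -/
theorem isLevel_zero_of_nonneg (hϖ0 : ϖ ≠ 0) (Λ : Module.Dual ℂ V) {B : V →ₗ⋆[ℂ] V →ₗ[ℂ] ℂ} (hBs : B.IsSymm)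
    (hBn : ∀ v : V, 0 ≤ (B v v).re) (hBl : ∀ v : V, B v v = 0 → Λ v = 0)
    (hBi : ∀ (g : GL (Fin (m + 1)) F) (v w : V), B (ρ g v) (ρ g w) = B v w) :
    IsLevel ρ ψ hϖ0 Λ B (Fin.last m) 0 where
  herm v w := (LinearMap.isSymm_def.1 hBs) v w
  nonneg := hBn
  invTL k _ _ v w := hBi k v w
  invCol x _ v w := hBi _ v w
  scale c _ _ v w := by rw [hBi, Nat.cast_zero, zero_mul, neg_zero, zpow_zero, one_mul]
  equivN t' _ htt' _ _ _ _ := absurd (Fin.le_last t') (not_le.2 htt')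
  lam := hBl

variable [TopologicalSpace F] [IsNonarchimedeanLocalField F]
  (hϖ : IsUniformizingElement ϖ) (hψ : ∀ c ∈ 𝒪[F], ψ c = 1) (hψ' : ∃ c ∈ 𝒪[F], ψ (ϖ⁻¹ * c) ≠ 1)
  (hρ : ρ.IsSmooth) {Λ : Module.Dual ℂ V} (hΛ : Λ ∈ whittakerFunctionals ρ ψ)
  {B : V →ₗ⋆[ℂ] V →ₗ[ℂ] ℂ} (hBs : B.IsSymm) (hBn : ∀ v : V, 0 ≤ (B v v).re) (hBl : ∀ v : V, B v v = 0 → Λ v = 0)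
  (hBi : ∀ (g : GL (Fin (m + 1)) F) (v w : V), B (ρ g v) (ρ g w) = B v w)
include hϖ hψ hψ' hρ hΛ hBs hBn hBl hBi

/-- **Every storey of the tower of a positive semi-definite invariant form is a level structure**
(`isLevel_levelForm` without positive-definiteness): the hypothesis `hLev` of `chain_level` and
`bessel_bound_level`. [folklore] -/
theorem isLevel_levelForm_of_nonneg {k : ℕ} (hk : k ≤ m) :
    IsLevel ρ ψ hϖ.ne_zero Λ (levelForm ρ ψ ϖ B k) (col m k) k := by
  induction k with
  | zero => exact isLevel_zero_of_nonneg (ψ := ψ) hϖ.ne_zero Λ hBs hBn hBl hBi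
  | succ k ih =>
    rw [levelForm_succ]
    exact (ih (by omega)).descend hϖ hψ hψ' hρ (by simp only [col_val]; omega) hΛ

end PsdTower

end WhittakerBessel

end Literature.NumberTheory.Automorphic
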